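import Literature.NumberTheory.GaloisRepresentations.LubinTateColemanRelativeKernelTwo
import Mathlib.RingTheory.MvPowerSeries.Expand
import Mathlib.Algebra.CharP.Quotient
import HarnessLib

/-!
# `q = 2`: de Shalit's congruences (i) `𝒩_E h ≡ h^φ (mod π)` and (iv) `h ≡ 1 (mod π^i) ⟹ 𝒩_E h ≡ 1 (mod π^{i+1})`
# with coefficients in `𝒪_E` (and a coefficient endomorphism `ψ` fixing `π` commutes with `τ_E`, `𝒩_E`, `𝒮_E`)

De Shalit, *Iwasawa theory of elliptic curves with complex multiplication* (1987), Ch. I §2.1 Proposition (i), (iv)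
(over an unramified base `k'` with Frobenius `φ`: `𝒩h ≡ h^φ (mod 𝔭')`, `h ≡ 1 (mod 𝔭'^i) ⟹ 𝒩h ≡ 1 (mod 𝔭'^{i+1})` —
the two congruences driving Coleman's interpolation `g = lim (𝒩^k h)^{φ^{-k}}`, I §2.2 (2)–(3)) and §3.13 (`h ↦ h̃`).
For `f = πX + X²` over `F` with `|𝓀_F| = 2`, any finite `E ⊇ F`, and the operators `𝒩_E`, `𝒮_E`, `τ_E` on `𝒪_E⟦X⟧` of
`LubinTateColemanRelativeTraceTwo` / `…RelativeKernelTwo`, EVERYTHING REDUCES TO ALGEBRA IN `𝒪_E⟦X⟧`; the only external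
input left for the unramified tower is a ring endomorphism `ψ` of `𝒪_E` with `ψ(π) = π` and `ψ(c) ≡ c² (mod π)` (the
Frobenius of `E/F`):

* `map_subst_map_ltSer`, ★ `map_reflE`, `map_relTraceTwo`, `map_relNormTwo` — **a coefficient endomorphism `ψ` fixing `π`
  commutes with `τ_E`, `𝒮_E`, `𝒩_E`** (via the rank-two decomposition; no continuity of `ψ` needed);
* `relNormTwo_one_add_C_pow_mul` and ★★ `relNormTwo_sub_one_mem` — **(iv): `h ≡ 1 (mod π^i)`, `i ≥ 1 ⟹ 𝒩_E h ≡ 1 (mod π^{i+1})`**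
  (`h·h(−π−X) = 1 + π^i(k + k(−π−X)) + π^{2i}k·k(−π−X)` and `im 𝒮_E = π𝒪_E⟦X⟧`);
* `sqCoeff E h = Σ h_i² X^i`, `two_mem_nonunits`, `sq_sub_expand_sqCoeff_mem` (`h² ≡ (Sq h)(X²) mod 2`, Frobenius of
  `(𝒪_E/2)⟦X⟧`), `mem_coeffIdeal_of_subst_mem_E` (`∘ f` reflects congruences mod `π`), and
  ★★★ `relNormTwo_sub_sqCoeff_mem` — **(i): `𝒩_E h ≡ Σ h_i² X^i (mod π)`**; `relNormTwo_sub_map_mem` — hence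
  **`𝒩_E h ≡ h^ψ (mod π)` for any `ψ` with `ψ(c) ≡ c² (mod π)`**;
0 sorry, no named facts.  The twisted `h ↦ h − u·(h^ψ ∘ f)` (I §3.13) is treated in `LubinTateColemanRelativeTildeTwo`.  Not here: the identification of `ψ` with the Frobenius of an unramified `E/F` (tree
`IsAbsArithFrob`, `maxUnramified`) and the tower `E·K_π^{n+1}` (sequel).

## References

* E. de Shalit, *Iwasawa theory of elliptic curves with complex multiplication* (1987), Ch. I §2.1 Proposition
  (i), (iv), §2.2, §3.13. [deShalit1987]
-/

noncomputable section

open scoped PowerSeries.WithPiTopology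

namespace Literature.NumberTheory.GaloisRepresentations
section LocalFieldRel2e

open GaloisRepresentations.IsNonarchimedeanLocalField LubinTate ValuativeRel

variable (F : Type*) [Field F] [ValuativeRel F] [TopologicalSpace F] [IsNonarchimedeanLocalField F]

attribute [local instance] ltNormUniformSpace ltNormIsUniformAddGroup rk1 nF nE fintypeResidueField

variable {F}
variable {π : 𝒪[F]} (hπ : (valuation F).IsUniformizer (π : F))
variable (E : IntermediateField F (AlgebraicClosure F)) [FiniteDimensional F E]

/-- `f` is substitutable (`f(0) = 0`). [folklore] -/
private theorem hasSubst_mapLtSer₄ :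
    PowerSeries.HasSubst ((ltSer F π).map (algebraMap (LTCoeff F) (unitBall E))) :=
  PowerSeries.HasSubst.of_constantCoeff_zero' ((isLTSeries_ltSer π).map _).constantCoeff_eq_zero

/-- `(R ∘ f)^ψ = R^ψ ∘ f` for a ring endomorphism `ψ` of `𝒪_E` fixing `π` (`f` has coefficients `π, 1`).
[cite: deShalit1987, Ch. I §2.1] -/
theorem map_subst_map_ltSer {ψ : unitBall E →+* unitBall E} (hψ : ψ (algebraMap 𝒪[F] (unitBall E) π) =
    algebraMap 𝒪[F] (unitBall E) π) (R : PowerSeries (unitBall E)) :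
    PowerSeries.map ψ (PowerSeries.subst ((ltSer F π).map (algebraMap (LTCoeff F) (unitBall E))) R) =
      PowerSeries.subst ((ltSer F π).map (algebraMap (LTCoeff F) (unitBall E))) (PowerSeries.map ψ R) := by
  have hf : ((ltSer F π).map (algebraMap (LTCoeff F) (unitBall E))).map ψ =
      (ltSer F π).map (algebraMap (LTCoeff F) (unitBall E)) := by
    have e : ltSer F π = PowerSeries.C (LTCoeff.of F π) * PowerSeries.X + PowerSeries.X ^ residueFieldCard F := by
      change ((ltPoly F π : Polynomial 𝒪[F]) : PowerSeries 𝒪[F]) = _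
      rw [ltPoly, Polynomial.coe_add, Polynomial.coe_mul, Polynomial.coe_pow, Polynomial.coe_C, Polynomial.coe_X]
      rfl
    rw [e, map_add, map_mul, map_pow, PowerSeries.map_C, PowerSeries.map_X, map_add, map_mul, map_pow,
      PowerSeries.map_C, PowerSeries.map_X]
    change PowerSeries.C (ψ (algebraMap 𝒪[F] (unitBall E) π)) * _ + _ = _
    rw [hψ]
    rfl
  have e : PowerSeries.map ψ (PowerSeries.subst ((ltSer F π).map (algebraMap (LTCoeff F) (unitBall E))) R) =
      PowerSeries.subst (((ltSer F π).map (algebraMap (LTCoeff F) (unitBall E))).map ψ) (PowerSeries.map ψ R) :=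
    PowerSeries.map_subst (hasSubst_mapLtSer₄ E) R
  rw [e, hf]

/-! ### A coefficient endomorphism `ψ` fixing `π` commutes with `τ_E`, `𝒩_E`, `𝒮_E` -/

/-- ★ **`(τ_E G)^ψ = τ_E (G^ψ)`** for a ring endomorphism `ψ` of `𝒪_E` fixing `π` (e.g. the Frobenius of an unramified
`E/F`): with `G = R₀ ∘ f + X·(R₁ ∘ f)` both sides are `R₀^ψ ∘ f + (−π − X)·(R₁^ψ ∘ f)` — no continuity of `ψ` needed.
[cite: deShalit1987, Ch. I §2.1] -/
theorem map_reflE (hq : residueFieldCard F = 2) {ψ : unitBall E →+* unitBall E}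
    (hψ : ψ (algebraMap 𝒪[F] (unitBall E) π) = algebraMap 𝒪[F] (unitBall E) π) (G : PowerSeries (unitBall E)) :
    PowerSeries.map ψ (reflE hπ E G) = reflE hπ E (PowerSeries.map ψ G) := by
  obtain ⟨R₀, R₁, hG⟩ := exists_eq_subst_add_X_mul_subst_E hπ E hq G
  have e1 : PowerSeries.map ψ (reflE hπ E G) =
      PowerSeries.subst ((ltSer F π).map (algebraMap (LTCoeff F) (unitBall E))) (PowerSeries.map ψ R₀) +
        (-PowerSeries.X - PowerSeries.C (algebraMap 𝒪[F] (unitBall E) π)) *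
          PowerSeries.subst ((ltSer F π).map (algebraMap (LTCoeff F) (unitBall E))) (PowerSeries.map ψ R₁) := by
    rw [hG, map_add, map_mul, reflE_X hπ E hq, reflE_subst hπ E hq, reflE_subst hπ E hq, map_add, map_mul, map_sub,
      map_neg, PowerSeries.map_X, PowerSeries.map_C, hψ, map_subst_map_ltSer E hψ, map_subst_map_ltSer E hψ]
  have e2 : PowerSeries.map ψ G =
      PowerSeries.subst ((ltSer F π).map (algebraMap (LTCoeff F) (unitBall E))) (PowerSeries.map ψ R₀) +
      PowerSeries.X * PowerSeries.subst ((ltSer F π).map (algebraMap (LTCoeff F) (unitBall E))) (PowerSeries.map ψ R₁) := by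
    rw [hG, map_add, map_mul, PowerSeries.map_X, map_subst_map_ltSer E hψ, map_subst_map_ltSer E hψ]
  rw [e1, e2, map_add, map_mul, reflE_X hπ E hq, reflE_subst hπ E hq, reflE_subst hπ E hq]

/-- ★ **`(𝒮_E G)^ψ = 𝒮_E (G^ψ)`.** [cite: deShalit1987, Ch. I §3.12] -/
theorem map_relTraceTwo (hq : residueFieldCard F = 2) {ψ : unitBall E →+* unitBall E}
    (hψ : ψ (algebraMap 𝒪[F] (unitBall E) π) = algebraMap 𝒪[F] (unitBall E) π) (G : PowerSeries (unitBall E)) :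
    PowerSeries.map ψ (relTraceTwo hπ E hq G) = relTraceTwo hπ E hq (PowerSeries.map ψ G) := by
  refine subst_map_ltSer_injective hπ E ?_
  change PowerSeries.subst ((ltSer F π).map (algebraMap (LTCoeff F) (unitBall E))) (PowerSeries.map ψ (relTraceTwo hπ E hq G)) =
    PowerSeries.subst ((ltSer F π).map (algebraMap (LTCoeff F) (unitBall E))) (relTraceTwo hπ E hq (PowerSeries.map ψ G))
  have e1 : PowerSeries.subst ((ltSer F π).map (algebraMap (LTCoeff F) (unitBall E)))
      (PowerSeries.map ψ (relTraceTwo hπ E hq G)) = PowerSeries.map ψ (G + reflE hπ E G) := by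
    rw [← map_subst_map_ltSer E hψ, subst_relTraceTwo]
  rw [e1, subst_relTraceTwo, (PowerSeries.map ψ).map_add, map_reflE hπ E hq hψ]

/-- ★ **`(𝒩_E G)^ψ = 𝒩_E (G^ψ)`.** [cite: deShalit1987, Ch. I §2.1] -/
theorem map_relNormTwo (hq : residueFieldCard F = 2) {ψ : unitBall E →+* unitBall E}
    (hψ : ψ (algebraMap 𝒪[F] (unitBall E) π) = algebraMap 𝒪[F] (unitBall E) π) (G : PowerSeries (unitBall E)) :
    PowerSeries.map ψ (relNormTwo hπ E hq G) = relNormTwo hπ E hq (PowerSeries.map ψ G) := by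
  refine subst_map_ltSer_injective hπ E ?_
  change PowerSeries.subst ((ltSer F π).map (algebraMap (LTCoeff F) (unitBall E))) (PowerSeries.map ψ (relNormTwo hπ E hq G)) =
    PowerSeries.subst ((ltSer F π).map (algebraMap (LTCoeff F) (unitBall E))) (relNormTwo hπ E hq (PowerSeries.map ψ G))
  have e1 : PowerSeries.subst ((ltSer F π).map (algebraMap (LTCoeff F) (unitBall E)))
      (PowerSeries.map ψ (relNormTwo hπ E hq G)) = PowerSeries.map ψ (G * reflE hπ E G) := by
    rw [← map_subst_map_ltSer E hψ, subst_relNormTwo]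
  rw [e1, subst_relNormTwo, (PowerSeries.map ψ).map_mul, map_reflE hπ E hq hψ]

/-! ### De Shalit's (iv) over `𝒪_E`: `h ≡ 1 (mod π^i)`, `i ≥ 1 ⟹ 𝒩_E h ≡ 1 (mod π^{i+1})` -/

/-- The polynomial identity behind (iv): `(1 + ak)(1 + at) = 1 + ac·T + a²·kt` when `k + t = cT`. [folklore] -/
private theorem one_add_mul_mul_one_add_mul {R : Type*} [CommRing R] (a c k t T : R) (hS : k + t = c * T) :
    (1 + a * k) * (1 + a * t) = 1 + a * c * T + a * a * (k * t) := by
  linear_combination a * hS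

/-- Constants pass through `∘ f`. [folklore] -/
private theorem subst_mapLtSer_C (c : unitBall E) : PowerSeries.subst ((ltSer F π).map (algebraMap (LTCoeff F) (unitBall E))) (PowerSeries.C c) = PowerSeries.C c := by
  rw [PowerSeries.C_eq_algebraMap, ← PowerSeries.coe_substAlgHom (hasSubst_mapLtSer₄ E), AlgHom.commutes]

/-- `(𝒩_E (1 + C a · k)) ∘ f = (1 + C a · k)(1 + C a · k(−π−X))`. [cite: deShalit1987, Ch. I §2.1 Proposition (iv)] -/
theorem subst_relNormTwo_one_add_C_mul (hq : residueFieldCard F = 2) (a : unitBall E) (k : PowerSeries (unitBall E)) :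
    PowerSeries.subst ((ltSer F π).map (algebraMap (LTCoeff F) (unitBall E))) (relNormTwo hπ E hq (1 + PowerSeries.C a * k)) =
      (1 + PowerSeries.C a * k) * (1 + PowerSeries.C a * reflE hπ E k) := by
  rw [subst_relNormTwo, map_add (reflE hπ E), map_one (reflE hπ E), map_mul (reflE hπ E), reflE_C]

/-- `(1 + C b · k' + C d · 𝒩_E k) ∘ f = 1 + C b · (k' ∘ f) + C d · k · k(−π−X)`. [cite: deShalit1987, Ch. I §2.1 Proposition (iv)] -/
theorem subst_one_add_C_mul_add_C_mul_relNormTwo (hq : residueFieldCard F = 2) (b d : unitBall E)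
    (k k' : PowerSeries (unitBall E)) :
    PowerSeries.subst ((ltSer F π).map (algebraMap (LTCoeff F) (unitBall E))) (1 + PowerSeries.C b * k' + PowerSeries.C d * relNormTwo hπ E hq k) =
      1 + PowerSeries.C b * PowerSeries.subst ((ltSer F π).map (algebraMap (LTCoeff F) (unitBall E))) k' + PowerSeries.C d * (k * reflE hπ E k) := by
  rw [← PowerSeries.coe_substAlgHom (hasSubst_mapLtSer₄ E), map_add, map_add, map_one, map_mul, map_mul,
    PowerSeries.coe_substAlgHom, subst_mapLtSer_C, subst_mapLtSer_C, subst_relNormTwo]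

/-- `(1 + π^i k)·(1 + π^i k(−π−X)) = 1 + π^{i+1} k' ∘ f + π^{2i} (k·k(−π−X))` read through `∘ f`:
**`𝒩_E (1 + π^i k) = 1 + π^{i+1} k' + π^{2i} 𝒩_E k`** where `𝒮_E k = π k'`. [cite: deShalit1987, Ch. I §2.1 Proposition (iv)] -/
theorem relNormTwo_one_add_C_pow_mul (hq : residueFieldCard F = 2) (i : ℕ) (k k' : PowerSeries (unitBall E))
    (hk' : relTraceTwo hπ E hq k = PowerSeries.C (algebraMap 𝒪[F] (unitBall E) π) * k') :
    relNormTwo hπ E hq (1 + PowerSeries.C ((algebraMap 𝒪[F] (unitBall E) π) ^ i) * k) =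
      1 + PowerSeries.C ((algebraMap 𝒪[F] (unitBall E) π) ^ (i + 1)) * k' + PowerSeries.C ((algebraMap 𝒪[F] (unitBall E) π) ^ (2 * i)) * relNormTwo hπ E hq k := by
  have hS : k + reflE hπ E k = PowerSeries.C (algebraMap 𝒪[F] (unitBall E) π) * PowerSeries.subst ((ltSer F π).map (algebraMap (LTCoeff F) (unitBall E))) k' := by
    rw [← subst_relTraceTwo hπ E hq k, hk', ← PowerSeries.coe_substAlgHom (hasSubst_mapLtSer₄ E), map_mul,
      PowerSeries.coe_substAlgHom, subst_mapLtSer_C]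
  have e1 : (algebraMap 𝒪[F] (unitBall E) π) ^ (i + 1) = (algebraMap 𝒪[F] (unitBall E) π) ^ i * (algebraMap 𝒪[F] (unitBall E) π) := pow_succ _ i
  have e2 : (algebraMap 𝒪[F] (unitBall E) π) ^ (2 * i) = (algebraMap 𝒪[F] (unitBall E) π) ^ i * (algebraMap 𝒪[F] (unitBall E) π) ^ i := by rw [two_mul, pow_add]
  refine subst_map_ltSer_injective hπ E ?_
  change PowerSeries.subst ((ltSer F π).map (algebraMap (LTCoeff F) (unitBall E))) (relNormTwo hπ E hq (1 + PowerSeries.C ((algebraMap 𝒪[F] (unitBall E) π) ^ i) * k)) =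
    PowerSeries.subst ((ltSer F π).map (algebraMap (LTCoeff F) (unitBall E))) (1 + PowerSeries.C ((algebraMap 𝒪[F] (unitBall E) π) ^ (i + 1)) * k' + PowerSeries.C ((algebraMap 𝒪[F] (unitBall E) π) ^ (2 * i)) * relNormTwo hπ E hq k)
  rw [subst_relNormTwo_one_add_C_mul hπ E hq, subst_one_add_C_mul_add_C_mul_relNormTwo hπ E hq, e1, e2,
    map_mul PowerSeries.C ((algebraMap 𝒪[F] (unitBall E) π) ^ i) (algebraMap 𝒪[F] (unitBall E) π), map_mul PowerSeries.C ((algebraMap 𝒪[F] (unitBall E) π) ^ i) ((algebraMap 𝒪[F] (unitBall E) π) ^ i)]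
  exact one_add_mul_mul_one_add_mul _ _ _ _ _ hS

/-- ★★ **`h ≡ 1 (mod π^i)` with `i ≥ 1` ⟹ `𝒩_E h ≡ 1 (mod π^{i+1})`** (`q = 2`, coefficients in `𝒪_E`): with `h = 1 + π^i k`,
`(𝒩_E h) ∘ f = h·h(−π−X) = 1 + π^i (k + k(−π−X)) + π^{2i} k·k(−π−X)`, where `k + k(−π−X) = (𝒮_E k) ∘ f ∈ π·𝒪_E⟦f⟧`
(`im 𝒮_E = π𝒪_E⟦X⟧`) and `k·k(−π−X) = (𝒩_E k) ∘ f`. [cite: deShalit1987, Ch. I §2.1 Proposition (iv)] -/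
theorem relNormTwo_sub_one_mem (hq : residueFieldCard F = 2) {i : ℕ} (hi : 1 ≤ i) {h : PowerSeries (unitBall E)}
    (hh : h - 1 ∈ coeffIdeal (Ideal.span {algebraMap 𝒪[F] (unitBall E) π ^ i})) :
    relNormTwo hπ E hq h - 1 ∈ coeffIdeal (Ideal.span {algebraMap 𝒪[F] (unitBall E) π ^ (i + 1)}) := by
  obtain ⟨k, hk⟩ := exists_eq_C_mul_of_mem_coeffIdeal_span hh
  obtain ⟨k', hk'⟩ := exists_relTraceTwo_eq_C_mul hπ E hq k
  have eh : h = 1 + PowerSeries.C ((algebraMap 𝒪[F] (unitBall E) π) ^ i) * k := by rw [← hk]; ring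
  rw [eh, relNormTwo_one_add_C_pow_mul hπ E hq i k k' hk', add_assoc, add_sub_cancel_left]
  exact add_mem (C_mul_mem_coeffIdeal (Ideal.mem_span_singleton_self _) _)
    (C_mul_mem_coeffIdeal (Ideal.mem_span_singleton.mpr (pow_dvd_pow (algebraMap 𝒪[F] (unitBall E) π) (by omega))) _)

/-! ### De Shalit's (i) over `𝒪_E`: `𝒩_E h ≡ Σ h_i² X^i (mod π)` -/

/-- The coefficientwise square `Sq h = Σ h_i² X^i` — the reduction of `h^φ` for any Frobenius lift `φ` (at `q = 2`).
[cite: deShalit1987, Ch. I §2.1 Proposition (i)] -/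
def sqCoeff (h : PowerSeries (unitBall E)) : PowerSeries (unitBall E) := PowerSeries.mk fun i => PowerSeries.coeff i h ^ 2

/-- `coeff i (Sq h) = (coeff i h)²`. [cite: deShalit1987, Ch. I §2.1 Proposition (i)] -/
theorem coeff_sqCoeff (h : PowerSeries (unitBall E)) (i : ℕ) :
    PowerSeries.coeff i (sqCoeff E h) = PowerSeries.coeff i h ^ 2 := by
  rw [sqCoeff, PowerSeries.coeff_mk]

/-- `Sq h` reduces to the Frobenius twist of `h̄` modulo any `J` with `char(𝒪_E/J) = 2`.
[cite: deShalit1987, Ch. I §2.1 Proposition (i)] -/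
theorem map_sqCoeff_eq (J : Ideal (unitBall E)) [CharP (unitBall E ⧸ J) 2] (h : PowerSeries (unitBall E)) :
    PowerSeries.map (Ideal.Quotient.mk J) (sqCoeff E h) =
      PowerSeries.map (frobenius _ 2) (PowerSeries.map (Ideal.Quotient.mk J) h) := by
  ext i
  rw [PowerSeries.coeff_map, PowerSeries.coeff_map, PowerSeries.coeff_map, coeff_sqCoeff, map_pow, frobenius_def]

include hπ in
/-- `2 ∈ 𝒪_E` is a non-unit (`‖2‖ ≤ ‖π‖ < 1`). [cite: deShalit1987, Ch. I §1.7] -/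
theorem two_mem_nonunits (hq : residueFieldCard F = 2) : (2 : unitBall E) ∈ nonunits (unitBall E) := by
  obtain ⟨t, ht⟩ := exists_two_eq_pi_mul hπ hq
  have h2 : (2 : unitBall E) = algebraMap (LTCoeff F) (unitBall E) (LTCoeff.of F π) * algebraMap (LTCoeff F) (unitBall E) t := by
    rw [← map_mul, ← ht, map_ofNat]
  rw [h2, mem_nonunits_iff]
  intro hu
  have hπu : IsUnit (algebraMap (LTCoeff F) (unitBall E) (LTCoeff.of F π)) := isUnit_of_mul_isUnit_left hu
  have hlt : ‖((algebraMap (LTCoeff F) (unitBall E) (LTCoeff.of F π) : unitBall E) : E)‖ < 1 :=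
    algebraMap_mem_maxNilIdeal_of_dvd hπ (dvd_refl π)
  obtain ⟨w, hw⟩ := hπu
  have h1 : ‖((w : unitBall E) : E)‖ * ‖((↑w⁻¹ : unitBall E) : E)‖ = 1 := by
    rw [← norm_mul, ← Subring.coe_mul, Units.mul_inv, OneMemClass.coe_one, norm_one]
  have hle : ‖((↑w⁻¹ : unitBall E) : E)‖ ≤ 1 := (mem_unitBall_iff E).mp (↑w⁻¹ : unitBall E).2
  rw [hw] at h1
  nlinarith [norm_nonneg ((↑w⁻¹ : unitBall E) : E), norm_nonneg
    ((algebraMap (LTCoeff F) (unitBall E) (LTCoeff.of F π) : unitBall E) : E)]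

include hπ in
/-- `h² ≡ (Sq h)(X²) (mod 2)` in `𝒪_E⟦X⟧` (the Frobenius of `(𝒪_E/2)⟦X⟧`). [cite: deShalit1987, Ch. I §2.1 Proposition (i)] -/
theorem sq_sub_expand_sqCoeff_mem (hq : residueFieldCard F = 2) (h : PowerSeries (unitBall E)) :
    h ^ 2 - PowerSeries.expand 2 two_ne_zero (sqCoeff E h) ∈ coeffIdeal (Ideal.span {(2 : unitBall E)}) := by
  haveI : Fact (Nat.Prime 2) := ⟨Nat.prime_two⟩
  have e2 : ((2 : ℕ) : unitBall E) = 2 := Nat.cast_ofNat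
  haveI : CharP (unitBall E ⧸ Ideal.span {(2 : unitBall E)}) 2 := by
    have := CharP.quotient (unitBall E) 2 (by rw [e2]; exact two_mem_nonunits hπ E hq)
    rwa [e2] at this
  rw [sub_mem_coeffIdeal_iff_map_mk_eq, map_pow, PowerSeries.map_expand, map_sqCoeff_eq, ← PowerSeries.map_expand]
  exact (MvPowerSeries.map_frobenius_expand (p := 2) (hp := two_ne_zero)
    (f := (PowerSeries.map (Ideal.Quotient.mk (Ideal.span {(2 : unitBall E)})) h : PowerSeries _))).symm

/-- `(∘ f)` reflects congruences modulo `π` in `𝒪_E⟦X⟧`: `D ∘ f ≡ 0 ⟹ D ≡ 0 (mod π)` (`D ∘ f ≡ D(X²)`).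
[cite: deShalit1987, Ch. I §2.1 (proof of (iv))] -/
theorem mem_coeffIdeal_of_subst_mem_E {D : PowerSeries (unitBall E)}
    (hD : PowerSeries.subst ((ltSer F π).map (algebraMap (LTCoeff F) (unitBall E))) D ∈
      coeffIdeal (Ideal.span {algebraMap 𝒪[F] (unitBall E) π})) (hq : residueFieldCard F = 2) :
    D ∈ coeffIdeal (Ideal.span {algebraMap 𝒪[F] (unitBall E) π}) := by
  have hf := (isLTSeries_ltSer (F := F) π).map (algebraMap (LTCoeff F) (unitBall E))
  rw [hq] at hf
  have h1 := subst_sub_expand_mem_coeffIdeal hf two_ne_zero D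
  have h2 : PowerSeries.expand 2 two_ne_zero D ∈ coeffIdeal (Ideal.span {algebraMap 𝒪[F] (unitBall E) π}) := by
    have := sub_mem hD h1
    rwa [sub_sub_cancel] at this
  intro n
  have := h2 (2 * n)
  rwa [PowerSeries.coeff_expand_mul] at this

/-- ★★★ **De Shalit's (i) over `𝒪_E` at `q = 2`: `𝒩_E h ≡ Σ h_i² X^i (mod π)`** for every `h ∈ 𝒪_E⟦X⟧`
(`(𝒩_E h)(f) = h·h(−π−X) ≡ h·h ≡ Σ h_i² X^{2i} ≡ (Sq h)(f) mod π`).  For `E/F` unramified and `φ` a Frobenius lift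
(`φ(c) ≡ c² mod π`) this is `𝒩_E h ≡ h^φ (mod π)`, see `relNormTwo_sub_map_mem`.
[cite: deShalit1987, Ch. I §2.1 Proposition (i)] -/
theorem relNormTwo_sub_sqCoeff_mem (hq : residueFieldCard F = 2) (h : PowerSeries (unitBall E)) :
    relNormTwo hπ E hq h - sqCoeff E h ∈ coeffIdeal (Ideal.span {algebraMap 𝒪[F] (unitBall E) π}) := by
  set p : unitBall E := algebraMap 𝒪[F] (unitBall E) π with hp
  obtain ⟨t, ht⟩ := exists_two_eq_pi_mul hπ hq
  have h2p : Ideal.span {(2 : unitBall E)} ≤ Ideal.span {p} := by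
    refine Ideal.span_singleton_le_span_singleton.mpr ⟨algebraMap (LTCoeff F) (unitBall E) t, ?_⟩
    change (2 : unitBall E) = algebraMap (LTCoeff F) (unitBall E) (LTCoeff.of F π) * _
    rw [← map_mul, ← ht, map_ofNat]
  -- (a) `τ_E h ≡ h (mod π)`, (b) `h² ≡ (Sq h)(X²) (mod 2)`, (c) `(Sq h)(X²) ≡ (Sq h) ∘ f (mod π)`
  have ha := reflE_sub_self_mem_span hπ E hq h
  have hb := coeffIdeal_mono h2p (sq_sub_expand_sqCoeff_mem hπ E hq h)
  have hf := (isLTSeries_ltSer (F := F) π).map (algebraMap (LTCoeff F) (unitBall E))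
  rw [hq] at hf
  have hc := subst_sub_expand_mem_coeffIdeal hf two_ne_zero (sqCoeff E h)
  -- assemble: `(𝒩h − Sq h) ∘ f ∈ coeffIdeal (π)`
  refine mem_coeffIdeal_of_subst_mem_E E ?_ hq
  rw [← PowerSeries.coe_substAlgHom (hasSubst_mapLtSer₄ E), map_sub, PowerSeries.coe_substAlgHom, subst_relNormTwo]
  have key : h * reflE hπ E h - PowerSeries.subst ((ltSer F π).map (algebraMap (LTCoeff F) (unitBall E))) (sqCoeff E h) =
      h * (reflE hπ E h - h) + (h ^ 2 - PowerSeries.expand 2 two_ne_zero (sqCoeff E h)) -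
        (PowerSeries.subst ((ltSer F π).map (algebraMap (LTCoeff F) (unitBall E))) (sqCoeff E h) -
          PowerSeries.expand 2 two_ne_zero (sqCoeff E h)) := by ring
  rw [key]
  exact sub_mem (add_mem (Ideal.mul_mem_left _ _ ha) hb) hc

/-- ★★ **`𝒩_E h ≡ h^ψ (mod π)` for a Frobenius lift `ψ`** (`ψ(c) ≡ c² mod π` on `𝒪_E`, e.g. the Frobenius automorphism of
an unramified `E/F`): de Shalit's (i) in the relative case, reduced to the coefficient congruence.
[cite: deShalit1987, Ch. I §2.1 Proposition (i)] -/
theorem relNormTwo_sub_map_mem (hq : residueFieldCard F = 2) {ψ : unitBall E →+* unitBall E}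
    (hψ : ∀ c : unitBall E, ψ c - c ^ 2 ∈ Ideal.span {algebraMap 𝒪[F] (unitBall E) π}) (h : PowerSeries (unitBall E)) :
    relNormTwo hπ E hq h - PowerSeries.map ψ h ∈ coeffIdeal (Ideal.span {algebraMap 𝒪[F] (unitBall E) π}) := by
  have h1 := relNormTwo_sub_sqCoeff_mem hπ E hq h
  have h2 : sqCoeff E h - PowerSeries.map ψ h ∈ coeffIdeal (Ideal.span {algebraMap 𝒪[F] (unitBall E) π}) := fun i => by
    rw [map_sub, coeff_sqCoeff, PowerSeries.coeff_map, ← neg_sub]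
    exact neg_mem (hψ _)
  have := add_mem h1 h2
  rwa [sub_add_sub_cancel] at this

end LocalFieldRel2e

end Literature.NumberTheory.GaloisRepresentations
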